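import Literature.AlgebraicGeometry.HodgeTheory.HardLefschetzPureDimensional
import Literature.AlgebraicGeometry.HodgeTheory.InvariantCyclesOfLefschetzClassSmoothProper
import Literature.AlgebraicGeometry.HodgeTheory.SpecialisationMapComplexPoints
import Literature.AlgebraicGeometry.HodgeTheory.HyperplaneSectionMonodromySmoothLocus
import Literature.AlgebraicGeometry.HodgeTheory.HypersurfaceComplexPoints
import Literature.AlgebraicGeometry.Motives.RelativeDimensionPieces
import Literature.AlgebraicTopology.SingularHomology.CohomologyDisjointOpenCover
import HarnessLib

/-!
# Deligne's invariant cycle theorem for smooth projective morphisms — proof of `Voisin2003_invariantCycles`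

Area `Literature/AlgebraicGeometry/Motives`. DISCHARGE of the named fact
`Motives.Voisin2003_invariantCycles` (file `FlatSubfamily`): for `U` smooth, quasi-compact and
separated over `ℂ` and `f : 𝒳 ⟶ U` smooth and projective over `U` (a closed immersion
`𝒳 ↪ U × ℙᵐ` over `U`, Voisin II Def. 4.14), every flat section of `Rⁿ f(ℂ)_* ℚ`
(`Motives.IsFlatSection`: locally the restriction of one class on the tube) is the family of
restrictions of one class of `Hⁿ(𝒳(ℂ); ℚ)` — Deligne 1968 (degeneration of the Leray spectral
sequence, Thm. 1.5 / Prop. 2.1), Voisin II Thm. 4.15, Lemma 4.17, Thm. 4.18.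

The tree already proves the theorem for a smooth projective FAMILY in the sense of
`Motives.IsSmoothProjectiveFamily` — geometrically irreducible fibres of one dimension `n₀` — and a
total space immersed in `ℙᵐ` (`HodgeTheory.invariantCycles_of_isSmoothProjectiveFamily`), and for
an arbitrary class with the Lefschetz condition on the fibres
(`HodgeTheory.invariantCycles_of_lefschetzClass`, `…_of_smooth_proper`). The printed statement is
about an arbitrary smooth projective MORPHISM: its fibres are smooth projective schemes which may
be reducible (disconnected), of several dimensions, or empty, and the base `U` need not be
quasi-projective. This file closes the gap:

* `isClosedImmersion_fiberι_comp_snd_left` — the fibres `𝒳_s` of `𝒳 ↪ U × ℙᵐ → U` are closed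
  subschemes of `ℙᵐ` (through the section `{s} × ℙᵐ`);
* `Voisin2003_invariantCycles_holds` — the theorem. `𝒳` is the disjoint union of the open and
  closed pieces `𝒳_d` on which `f` has relative dimension `d` (`exists_relativeDimensionPieces`);
  on `𝒳_d` the pull-back of a generator of `H²(ℙᵐ(ℂ); ℂ)` is a fibrewise Lefschetz class in
  dimension `d` (hard Lefschetz for the pure-dimensional, possibly reducible fibres:
  `HodgeTheory.hasHardLefschetzProperty_of_smoothOfRelativeDimension`) and the fibres have no
  homology above degree `2d`, so the engine `HodgeTheory.invariantCycles_of_lefschetzClass_of_smooth_proper`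
  extends the restricted flat section over `𝒳_d(ℂ)`; the classes on the pieces glue over the clopen
  partition `𝒳(ℂ) = ∐_d 𝒳_d(ℂ)` (`singularCohomology.piRestrict_bijective`, Hatcher §3.1 p. 202),
  and the glued class restricts to the given section because `𝒳_s(ℂ) = ∐_d 𝒳_{d,s}(ℂ)`.

Everything is proved; no definition and no named fact is introduced (D-0026). The finer statement
with a smooth compactification (Deligne 1971, 4.1.1; Voisin II Thm. 4.24) is not touched.

## References

* [VoisinHodgeII2003] C. Voisin, Hodge Theory and Complex Algebraic Geometry II (CUP 2003),
  Def. 4.14, Thm. 4.15, Rem. 4.16, Lemma 4.17, Thm. 4.18 (pp. 124–126).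
* [Deligne1968] P. Deligne, Théorème de Lefschetz et critères de dégénérescence de suites
  spectrales, Publ. Math. IHÉS 35 (1968), Thm. 1.5, Prop. 2.1.
* [HatcherAT2002] A. Hatcher, Algebraic Topology (CUP 2002), Prop. 2.6, §3.1 p. 202.
* [Hartshorne1977] R. Hartshorne, Algebraic Geometry (1977), II.3, II Ex. 4.9, III.10.
-/

noncomputable section

open CategoryTheory CategoryTheory.Limits AlgebraicGeometry MonoidalCategory Set Function
open Literature.AlgebraicTopology.SingularHomology
open Literature.AlgebraicTopology.Homotopy
open Literature.Geometry.Kaehler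
open Literature.AlgebraicGeometry.HodgeTheory

namespace Literature.AlgebraicGeometry.Motives

open _root_.Topology

/-! ### Fibres of a family embedded in `S × ℙᵐ` embed in `ℙᵐ` -/

section FibreEmbedding

variable {U 𝒳 : SchemeOver ℂ} (f : 𝒳 ⟶ U) {m : ℕ}

/-- A `k`-scheme has exactly one `k`-morphism to `Spec k` (local copy of
`Motives.subsingleton_hom_specOver_self`, file `ConstantFamilyFibre`, not imported here). [folklore] -/
private theorem subsingleton_hom_specOver₁ (X : SchemeOver ℂ) : Subsingleton (X ⟶ specOver ℂ ℂ) := by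
  refine ⟨fun a b => Over.OverMorphism.ext ?_⟩
  have key : ∀ c : X ⟶ specOver ℂ ℂ, c.left = X.hom := fun c => by
    have h := Over.w c
    simp only [Over.mk_hom, Algebra.algebraMap_self, CommRingCat.ofHom_id, Spec.map_id] at h
    erw [Category.comp_id] at h
    exact h
  rw [key a, key b]

/-- **The fibres of a family `𝒳 ↪ U × ℙᵐ → U` are closed subschemes of `ℙᵐ`.** If
`ι : 𝒳 ⟶ U ⊗ ℙᵐ` is a closed immersion over `U` (`ι ≫ pr₁ = f`; Voisin II Def. 4.14: `f` is
projective) and `U` is locally of finite type over `ℂ` (so that complex points are closed points),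
then for every complex point `s` of `U` the composite `𝒳_s ↪ 𝒳 ↪ U × ℙᵐ → ℙᵐ` is a closed
immersion: `𝒳_s ↪ U × ℙᵐ` is a closed immersion which factors through the section
`ℙᵐ ≅ {s} × ℙᵐ ↪ U × ℙᵐ` of `pr₂`, a separated morphism. [cite: VoisinHodgeII2003, Def. 4.14]
[cite: Hartshorne1977, II Ex. 4.9] -/
theorem isClosedImmersion_fiberι_comp_snd_left [LocallyOfFiniteType U.hom]
    (ι : 𝒳 ⟶ U ⊗ projectiveSpace m ℂ) [IsClosedImmersion ι.left]
    (hι : ι ≫ CartesianMonoidalCategory.fst U (projectiveSpace m ℂ) = f) (s : ComplexPoints U) :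
    IsClosedImmersion
      (fiberι f s ≫ ι ≫ CartesianMonoidalCategory.snd U (projectiveSpace m ℂ)).left := by
  -- the section `b = (s, id) : ℙᵐ ⟶ U × ℙᵐ` of `pr₂`
  obtain ⟨b, hb⟩ : ∃ b : projectiveSpace m ℂ ⟶ U ⊗ projectiveSpace m ℂ,
      b = CartesianMonoidalCategory.lift (toSpecOver (projectiveSpace m ℂ) ≫ s) (𝟙 _) := ⟨_, rfl⟩
  have hgb : (fiberι f s ≫ ι ≫ CartesianMonoidalCategory.snd U (projectiveSpace m ℂ)) ≫ b =
      fiberι f s ≫ ι := by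
    refine CartesianMonoidalCategory.hom_ext _ _ ?_ ?_
    · haveI := subsingleton_hom_specOver₁ (fiberOver f s)
      have h1 : (fiberι f s ≫ ι) ≫ CartesianMonoidalCategory.fst U (projectiveSpace m ℂ) =
          fiberOverToSpec f s ≫ s := by
        rw [Category.assoc, hι, fiberι_comp]
      have h2 : ((fiberι f s ≫ ι ≫ CartesianMonoidalCategory.snd U (projectiveSpace m ℂ)) ≫ b) ≫
          CartesianMonoidalCategory.fst U (projectiveSpace m ℂ) =
          ((fiberι f s ≫ ι ≫ CartesianMonoidalCategory.snd U (projectiveSpace m ℂ)) ≫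
            toSpecOver (projectiveSpace m ℂ)) ≫ s := by
        rw [hb, Category.assoc, CartesianMonoidalCategory.lift_fst]
        simp only [Category.assoc]
      rw [h1, h2, Subsingleton.elim ((fiberι f s ≫ ι ≫ CartesianMonoidalCategory.snd U
        (projectiveSpace m ℂ)) ≫ toSpecOver (projectiveSpace m ℂ)) (fiberOverToSpec f s)]
    · rw [hb, Category.assoc, CartesianMonoidalCategory.lift_snd, Category.comp_id, Category.assoc]
  -- `𝒳_s ↪ 𝒳 ↪ U × ℙᵐ` is a closed immersion (complex points are closed points)
  haveI : IsClosedImmersion s.left := AlgPoints.isClosedImmersion_toSpecHom U s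
  haveI : IsClosedImmersion (fiberι f s).left :=
    MorphismProperty.pullback_fst (P := @IsClosedImmersion) f.left s.left inferInstance
  haveI : IsClosedImmersion (fiberι f s ≫ ι).left := by rw [Over.comp_left]; infer_instance
  haveI : IsClosedImmersion
      ((fiberι f s ≫ ι ≫ CartesianMonoidalCategory.snd U (projectiveSpace m ℂ)).left ≫ b.left) := by
    rw [← Over.comp_left, hgb]; infer_instance
  -- `b` is separated (it has the retraction `pr₂`)
  haveI : IsSeparated (b.left ≫ (CartesianMonoidalCategory.snd U (projectiveSpace m ℂ)).left) := by
    rw [← Over.comp_left, hb, CartesianMonoidalCategory.lift_snd]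
    change IsSeparated (𝟙 (projectiveSpace m ℂ).left)
    infer_instance
  haveI : IsSeparated b.left :=
    IsSeparated.of_comp b.left (CartesianMonoidalCategory.snd U (projectiveSpace m ℂ)).left
  exact IsClosedImmersion.of_comp _ b.left

end FibreEmbedding

/-! ### The theorem -/

section Main

/-- **Deligne's invariant cycle theorem for smooth projective morphisms — discharge of the named
fact `Motives.Voisin2003_invariantCycles`** (Deligne 1968, Thm. 1.5 / Prop. 2.1; Voisin II,
Thm. 4.18 with Def. 4.14, Thm. 4.15, Lemma 4.17; `ℚ`-statement). Let `U` be smooth, quasi-compact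
and separated over `ℂ`, `f : 𝒳 ⟶ U` smooth and projective over `U` (`𝒳 ↪ U × ℙᵐ` a closed immersion
over `U`). Then every flat section `y` of `Rⁿ f(ℂ)_* ℚ` (`Motives.IsFlatSection`) is the family of
restrictions of one class `z ∈ Hⁿ(𝒳(ℂ); ℚ)`.

Proof. `f = ι ≫ pr₁` is proper. Decompose `𝒳 = ∐_d 𝒳_d` into the open and closed pieces on which
`f` has relative dimension `d` (`exists_relativeDimensionPieces`). For each `d`, the family
`f_d : 𝒳_d ↪ 𝒳 → U` is smooth and proper, its fibre `𝒳_{d,s}` is smooth of relative dimension `d`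
over `ℂ` and embeds in `ℙᵐ` (`isClosedImmersion_fiberι_comp_snd_left`), so the pull-back `η_d` of a
generator of `H²(ℙᵐ(ℂ); ℂ)` restricts on every fibre to a class with the hard Lefschetz property in
dimension `d` and the fibres have no homology above degree `2d`
(`hasHardLefschetzProperty_of_smoothOfRelativeDimension`,
`isZero_singularHomology_of_smoothOfRelativeDimension` — the fibres may be reducible or empty);
the flat section restricts to a flat section `y_d` of `Rⁿ (f_d)_* ℚ` (pull back the tube classes
along `𝒳_d ↪ 𝒳`), which by the engine `invariantCycles_of_lefschetzClass_of_smooth_proper`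
(Serre fibration, Deligne's degeneration criterion on the Leray–Serre exact couple) comes from a
class `z_d ∈ Hⁿ(𝒳_d(ℂ); ℚ)`. The `𝒳_d(ℂ)` form a clopen partition of `𝒳(ℂ)`, so the `z_d` glue to
one class `z` (`Hⁿ(𝒳) ≅ ∏_d Hⁿ(𝒳_d)`, Hatcher §3.1 p. 202); on the fibre `𝒳_s(ℂ) = ∐_d 𝒳_{d,s}(ℂ)`
the class `z|_{𝒳_s} - y_s` dies on every piece, hence vanishes.
[cite: VoisinHodgeII2003, Thm. 4.18 (with Def. 4.14, Thm. 4.15, Lemma 4.17)]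
[cite: Deligne1968, Thm. 1.5 and Prop. 2.1] [cite: HatcherAT2002, §3.1 p. 202] -/
theorem Voisin2003_invariantCycles_holds : Voisin2003_invariantCycles := by
  intro U 𝒳 f n hU hUqc hUsep hf hι y hy
  classical
  obtain ⟨m, ι, hιci, hιf⟩ := hι
  haveI := hU
  haveI := hUqc
  haveI := hUsep
  haveI := hf
  haveI := hιci
  haveI : CompactSpace U.left := QuasiCompact.compactSpace_of_compactSpace U.hom
  haveI : LocallyOfFiniteType U.hom := inferInstance
  -- `f = ι ≫ pr₁` is proper
  haveI : IsProper (CartesianMonoidalCategory.fst U (projectiveSpace m ℂ)).left := by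
    haveI := isProper_projectiveSpace m ℂ
    exact inferInstanceAs (IsProper (pullback.fst U.hom (projectiveSpace m ℂ).hom))
  haveI : IsProper f.left := by
    rw [← hιf, Over.comp_left]
    infer_instance
  -- the open and closed pieces `𝒳_d` on which `f` has relative dimension `d`
  obtain ⟨piece, hsm, hcov, huniq, hclosed⟩ := exists_relativeDimensionPieces f.left
  let 𝒳d : ℕ → SchemeOver ℂ := fun d => Over.mk ((piece d).ι ≫ 𝒳.hom)
  let j : ∀ d, 𝒳d d ⟶ 𝒳 := fun d => Over.homMk (piece d).ι rfl
  haveI hjo : ∀ d, IsOpenImmersion (j d).left := fun d =>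
    inferInstanceAs (IsOpenImmersion (piece d).ι)
  haveI hjc : ∀ d, IsClosedImmersion (j d).left := fun d => by
    refine IsClosedImmersion.of_isPreimmersion _ ?_
    change IsClosed (Set.range (piece d).ι)
    rw [Scheme.Opens.range_ι]
    exact hclosed d
  -- a generator of `H²(ℙᵐ(ℂ); ℂ)`, hard Lefschetz on every smooth projective subvariety
  obtain ⟨r₀, hr₀⟩ := exists_forall_hasHardLefschetzProperty_map m
  -- Deligne's theorem for each piece `f_d = j_d ≫ f : 𝒳_d ⟶ U`
  have hpiece : ∀ d, ∃ z : bettiCohomology (𝒳d d) n,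
      ∀ s, (bettiCohomology.map (fiberι (j d ≫ f) s) n).hom z =
        (bettiCohomology.map (fiberOverMap (j d) f s) n).hom (y s) := by
    intro d
    haveI : Smooth (j d ≫ f).left := by rw [Over.comp_left]; infer_instance
    haveI : IsProper (j d ≫ f).left := by rw [Over.comp_left]; infer_instance
    have hsmd : SmoothOfRelativeDimension d (j d ≫ f).left := hsm d
    haveI : IsClosedImmersion (j d ≫ ι).left := by rw [Over.comp_left]; infer_instance
    have hιd : (j d ≫ ι) ≫ CartesianMonoidalCategory.fst U (projectiveSpace m ℂ) = j d ≫ f := by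
      rw [Category.assoc, hιf]
    -- the fibres of `f_d`: smooth of relative dimension `d`, closed in `ℙᵐ`
    have hfib : ∀ s : ComplexPoints U, SmoothOfRelativeDimension d (fiberOver (j d ≫ f) s).hom := by
      intro s
      haveI : SmoothOfRelativeDimension d ((j d ≫ f).left ∣_ (⊤ : U.left.Opens)) :=
        IsZariskiLocalAtTarget.restrict hsmd ⊤
      exact smoothOfRelativeDimension_fiberOver_hom (j d ≫ f) ⊤ s trivial
    have hκ : ∀ s : ComplexPoints U, IsClosedImmersion
        (fiberι (j d ≫ f) s ≫ (j d ≫ ι) ≫ CartesianMonoidalCategory.snd U (projectiveSpace m ℂ)).left :=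
      fun s => isClosedImmersion_fiberι_comp_snd_left (j d ≫ f) (j d ≫ ι) hιd s
    -- the Lefschetz class `η_d = (𝒳_d → ℙᵐ)^* r₀`
    have hη : ∀ s : ComplexPoints U,
        HasHardLefschetzProperty (complexBetti.map (fiberι (j d ≫ f) s) 2
          (complexBetti.map ((j d ≫ ι) ≫ CartesianMonoidalCategory.snd U (projectiveSpace m ℂ)) 2 r₀)) d := by
      intro s
      haveI := hfib s
      haveI := hκ s
      have h := hasHardLefschetzProperty_of_smoothOfRelativeDimension (d := d)
        (fiberι (j d ≫ f) s ≫ (j d ≫ ι) ≫ CartesianMonoidalCategory.snd U (projectiveSpace m ℂ)) hr₀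
      rwa [complexBetti.map_comp, ModuleCat.comp_apply] at h
    have hvan : ∀ (s : ComplexPoints U) (k : ℕ), 2 * d < k →
        IsZero (singularHomology ℂ ℂ (ComplexPoints (fiberOver (j d ≫ f) s)) k) := by
      intro s k hk
      haveI := hfib s
      haveI := hκ s
      exact isZero_singularHomology_of_smoothOfRelativeDimension (d := d) ⟨m, _, hκ s⟩ ℂ hk
    -- the flat section restricted to the piece
    have hyd : IsFlatSection (j d ≫ f) n
        fun s => (bettiCohomology.map (fiberOverMap (j d) f s) n).hom (y s) := by
      intro s₀
      obtain ⟨V, hV, g, hg⟩ := hy s₀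
      -- the map of tubes `(j_d ≫ f)⁻¹V(ℂ) → f⁻¹V(ℂ)`
      have hmem : ∀ w : tube (j d ≫ f) V, ∃ s ∈ V, ∃ x : ComplexPoints (fiberOver f s),
          AlgPoints.map (fiberι f s) x = AlgPoints.map (j d) w.1 := fun w => by
        obtain ⟨s, hs, x, hx⟩ := w.2
        exact ⟨s, hs, AlgPoints.map (fiberOverMap (j d) f s) x, by
          rw [AlgPoints.map_fiberι_map_fiberOverMap, hx]⟩
      let T : C(tube (j d ≫ f) V, tube f V) :=
        ⟨fun w => ⟨AlgPoints.map (j d) w.1, hmem w⟩,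
          ((AlgPoints.mapContinuous (L := ℂ) (j d)).continuous.comp continuous_subtype_val).subtype_mk
            hmem⟩
      refine ⟨V, hV, (singularCohomology.map ℚ ℚ T n).hom g, fun s hs => ?_⟩
      have hT : T.comp (fiberToTube (j d ≫ f) V s hs) =
          (fiberToTube f V s hs).comp (AlgPoints.mapContinuous (L := ℂ) (fiberOverMap (j d) f s)) :=
        ContinuousMap.ext fun x => Subtype.ext (AlgPoints.map_fiberι_map_fiberOverMap (j d) f s x).symm
      rw [tubeRestrict_def, ← ModuleCat.comp_apply, ← singularCohomology.map_comp, hT,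
        singularCohomology.map_comp, ModuleCat.comp_apply, ← tubeRestrict_def, hg s hs]
    exact invariantCycles_of_lefschetzClass_of_smooth_proper (j d ≫ f) d _ hη hvan n _ hyd
  choose z hz using hpiece
  -- the clopen partition `{𝒳_d(ℂ)}` of `𝒳(ℂ)`
  let B : ℕ → Set (ComplexPoints 𝒳) := fun d => Set.range (AlgPoints.map (L := ℂ) (j d))
  have hBrange : ∀ d, B d = {P : ComplexPoints 𝒳 | P.pt ∈ piece d} := by
    intro d
    change Set.range (AlgPoints.map (L := ℂ) (j d)) = _
    rw [AlgPoints.range_map_of_isOpenImmersion_holds (L := ℂ) (j d)]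
    ext P
    change P.pt ∈ (((piece d).ι.opensRange : 𝒳.left.Opens) : Set 𝒳.left) ↔ P.pt ∈ (piece d : Set 𝒳.left)
    rw [Scheme.Opens.opensRange_ι]
  have hB : IsClopenPartition B := by
    refine IsClopenPartition.of_pairwise_disjoint (fun d => ?_) (fun d d' hne => ?_) ?_
    · exact (AlgPoints.isOpenEmbedding_map_holds (L := ℂ) (j d)).isOpen_range
    · change Disjoint (B d) (B d')
      rw [hBrange, hBrange, Set.disjoint_left]
      exact fun P h h' => hne (huniq d d' P.pt h h')
    · refine Set.eq_univ_of_forall fun P => Set.mem_iUnion.mpr ?_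
      obtain ⟨d, hd⟩ := hcov P.pt
      exact ⟨d, by rw [hBrange]; exact hd⟩
  -- glue the `z_d`
  have hemb : ∀ d, IsEmbedding (AlgPoints.map (L := ℂ) (j d)) := fun d =>
    (AlgPoints.isOpenEmbedding_map_holds (L := ℂ) (j d)).isEmbedding
  obtain ⟨w, hw⟩ := singularCohomology.exists_forall_map_subsetIncl_eq (R := ℚ) (M := ℚ) hB
    fun d => singularCohomology.map ℚ ℚ
      ((hemb d).toHomeomorph.symm : C(B d, ComplexPoints (𝒳d d))) n (z d)
  have hwz : ∀ d, (bettiCohomology.map (j d) n).hom w = z d := by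
    intro d
    have hcomp : (subsetIncl (B d)).comp ((hemb d).toHomeomorph : C(ComplexPoints (𝒳d d), B d)) =
        AlgPoints.mapContinuous (L := ℂ) (j d) := ContinuousMap.ext fun _ => rfl
    change singularCohomology.map ℚ ℚ (AlgPoints.mapContinuous (L := ℂ) (j d)) n w = z d
    rw [← hcomp, singularCohomology.map_comp, ModuleCat.comp_apply, hw d]
    exact SerreFlat.map_homeomorph_map_symm ℚ (hemb d).toHomeomorph n (z d)
  refine ⟨w, fun s => ?_⟩
  -- on the fibre: `𝒳_s(ℂ) = ∐_d 𝒳_{d,s}(ℂ)` via the closed immersions `𝒳_{d,s} ⟶ 𝒳_s`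
  haveI : IsClosedImmersion s.left := AlgPoints.isClosedImmersion_toSpecHom U s
  haveI : IsClosedImmersion (fiberι f s).left :=
    MorphismProperty.pullback_fst (P := @IsClosedImmersion) f.left s.left inferInstance
  haveI hφc : ∀ d, IsClosedImmersion (fiberOverMap (j d) f s).left := fun d => by
    haveI : IsClosedImmersion (fiberι (j d ≫ f) s).left :=
      MorphismProperty.pullback_fst (P := @IsClosedImmersion) (j d ≫ f).left s.left inferInstance
    haveI : IsClosedImmersion ((fiberOverMap (j d) f s).left ≫ (fiberι f s).left) := by
      rw [← Over.comp_left, fiberOverMap_comp_fiberι, Over.comp_left]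
      infer_instance
    exact IsClosedImmersion.of_comp _ (fiberι f s).left
  let A : ℕ → Set (ComplexPoints (fiberOver f s)) := fun d =>
    Set.range (AlgPoints.map (L := ℂ) (fiberOverMap (j d) f s))
  have hArange : ∀ d, A d = (AlgPoints.map (L := ℂ) (fiberι f s)) ⁻¹' (B d) := by
    intro d
    ext P
    constructor
    · rintro ⟨x, rfl⟩
      exact ⟨AlgPoints.map (fiberι (j d ≫ f) s) x, (AlgPoints.map_fiberι_map_fiberOverMap (j d) f s x).symm⟩
    · rintro ⟨w', hw'⟩
      have hs' : AlgPoints.map (j d ≫ f) w' = s := by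
        rw [AlgPoints.map_comp_apply, hw', AlgPoints.map_map_fiberι]
      obtain ⟨x, hx⟩ : ∃ x : ComplexPoints (fiberOver (j d ≫ f) s),
          AlgPoints.map (fiberι (j d ≫ f) s) x = w' := by
        have h : w' ∈ AlgPoints.map (j d ≫ f) ⁻¹' {s} := hs'
        rwa [← AlgPoints.range_map_fiberι] at h
      refine ⟨x, AlgPoints.map_injective (fiberι f s) ?_⟩
      rw [AlgPoints.map_fiberι_map_fiberOverMap, hx, hw']
  have hA : IsClopenPartition A := by
    refine IsClopenPartition.of_pairwise_disjoint (fun d => ?_) (fun d d' hne => ?_) ?_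
    · rw [hArange]
      exact (hB.isOpen d).preimage (AlgPoints.continuous_map _)
    · change Disjoint (A d) (A d')
      rw [hArange, hArange]
      exact (hB.disjoint hne).preimage _
    · refine Set.eq_univ_of_forall fun P => Set.mem_iUnion.mpr ?_
      obtain ⟨d, hd⟩ := hB.exists_mem (AlgPoints.map (fiberι f s) P)
      exact ⟨d, by rw [hArange]; exact hd⟩
  -- `w|_{𝒳_s} - y_s` dies on every piece `𝒳_{d,s}(ℂ)`
  rw [← sub_eq_zero]
  refine singularCohomology.eq_zero_of_forall_map_subsetIncl_eq_zero (R := ℚ) (M := ℚ) hA fun d => ?_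
  have key : (bettiCohomology.map (fiberOverMap (j d) f s) n).hom
      ((bettiCohomology.map (fiberι f s) n).hom w) =
      (bettiCohomology.map (fiberOverMap (j d) f s) n).hom (y s) := by
    rw [← ModuleCat.comp_apply, ← bettiCohomology.map_comp, fiberOverMap_comp_fiberι,
      bettiCohomology.map_comp, ModuleCat.comp_apply, hwz d, hz d s]
  have hembd := AlgPoints.isEmbedding_map_of_isClosedImmersion (L := ℂ) (fiberOverMap (j d) f s)
  have hcomp : (subsetIncl (A d)).comp
      (hembd.toHomeomorph : C(ComplexPoints (fiberOver (j d ≫ f) s), A d)) =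
      AlgPoints.mapContinuous (L := ℂ) (fiberOverMap (j d) f s) := ContinuousMap.ext fun _ => rfl
  have h2 : singularCohomology.map ℚ ℚ (AlgPoints.mapContinuous (L := ℂ) (fiberOverMap (j d) f s)) n
      ((bettiCohomology.map (fiberι f s) n).hom w - y s) = 0 := by
    rw [map_sub]
    exact sub_eq_zero.mpr key
  rw [← hcomp, singularCohomology.map_comp, ModuleCat.comp_apply] at h2
  have h3 := congrArg (singularCohomology.map ℚ ℚ
    (hembd.toHomeomorph.symm : C(A d, ComplexPoints (fiberOver (j d ≫ f) s))) n) h2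
  rwa [SerreFlat.map_symm_map_homeomorph, map_zero] at h3

end Main

end Literature.AlgebraicGeometry.Motives

end
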